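import Literature.NumberTheory.GaloisCohomology.CorrectionAtPOfCharacterReal
import Literature.NumberTheory.GaloisCohomology.ArtinMapInfiniteIdelesSplit
import Literature.NumberTheory.GaloisCohomology.PoitouTateTotallyComplex
import HarnessLib

/-!
# `∑_v inv_v = 0` on the finite places for classes of `H²(Γ_K, μ_{p^k})` vanishing at the real places
# — every number field `K`, every prime `p` (Tate, Cassels–Fröhlich VII §10–§11)

The (F1) chain of `pub/bsd-cn100` proved Tate's reciprocity law `∑_v inv_v (loc_v y) = 0` for classes
`y ∈ H²(Γ_K, μ_{p^{m+1}})` with finitely supported invariants, for `K` totally complex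
(`PoitouTateTotallyComplex.lean`) and for `p` odd (`PoitouTateOddPrimePower.lean`).  The remaining case
— `p = 2` over a number field with real places — needs exactly one new hypothesis: the class must VANISH
AT THE REAL PLACES (otherwise it does not die in the cyclotomic `ℤ_2`-tower, which is split at the real
places).  This file proves the finite-place sum formula under that hypothesis, for every `K` and `p`:

* **`sum_localInvariantMap_localization_eq_zero_of_forall_isReal`** — for `y ∈ H²(Γ_K, μ_{p^{m+1}})` with
  `inv_v (loc_v y) = 0` off the finite set `S` of finite places and `loc_w y = 0` at every real `w`:
  `∑_{v ∈ S} inv_v (loc_v y) = 0`.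

Proof (the tree's N6 assembly with the `∀ K` nodes of this generation): correct `y ↦ y'` above `p` with a
totally positive auxiliary element, preserving real-vanishing (`exists_correction_trivial_above_p_real`);
kill `y'` on a layer `K_M` of the cyclotomic `ℤ_p`-extension
(`exists_resH_comap_span_pow_kummer_eq_zero_of_forall_isReal` — this is where real-vanishing is used);
write `y' = κ(b) ∪ ψ_M` (`exists_eq_cupProduct_δ₀_of_resH_eq_zero`); the layer `K_M/K` is unramified
outside `p` (where `y'` vanishes) and SPLIT AT THE REAL PLACES, so `ψ_{K_M|K}` kills `(b)_∞`
(`artinIdeleMap_layer_infiniteIdeles_eq_one`) and the cyclic reciprocity law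
`sum_localInvariantMap_localization_cupProduct_δ₀_eq_zero` applies.  Theorems only (D-0026); node (N6)
of the `∀ K` form of `poitouTate_sum_localTatePairing_eq_zero` (seat transfer-2 g5).

## References

* J. Tate, *Global class field theory*, Ch. VII of Cassels–Fröhlich (1967), §9.6, §10, §11. [CasselsFrohlichANT1967]
* J. S. Milne, *Arithmetic Duality Theorems* (2006), Ch. I Thm. 4.10 (b). [MilneADT2006]
* J.-P. Serre, *Cohomologie galoisienne* (1997), II §4.4. [SerreGaloisCohomology1997]
-/

noncomputable section

open CategoryTheory Function Field NumberField IsDedekindDomain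
open scoped NumberField

namespace Literature.NumberTheory.GaloisCohomology

open _root_.ContinuousCohomology
open Literature.NumberTheory.GaloisRepresentations
open Literature.NumberTheory.GaloisRepresentations.DiscreteGaloisModule
open Literature.NumberTheory.GaloisRepresentations.LocalWeilDatum
open Literature.NumberTheory.EllipticCurves
open Literature.AnabelianGeometry.AbsoluteAnabelian
open Literature.AnabelianGeometry.AbsoluteAnabelian.Prop121vii

variable (K : Type) [Field K] [NumberField K] (p : ℕ) [hp : Fact p.Prime]

/-- A multiple `x.val · p^(e-m-1)` read in `ℤ/p^e` vanishes only if `x = 0` (`x ∈ ℤ/p^(m+1)`,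
`m + 1 ≤ e`). [folklore] -/
private theorem eq_zero_of_val_mul_pow_eq_zero {m e : ℕ} (hme : m + 1 ≤ e) (x : ZMod (p ^ (m + 1)))
    (h : ((x.val * p ^ (e - m - 1) : ℕ) : ZMod (p ^ e)) = 0) : x = 0 := by
  have hpp : p.Prime := hp.out
  rw [ZMod.natCast_eq_zero_iff] at h
  have hlt : x.val * p ^ (e - m - 1) < p ^ e := by
    calc x.val * p ^ (e - m - 1) < p ^ (m + 1) * p ^ (e - m - 1) :=
          Nat.mul_lt_mul_of_lt_of_le (ZMod.val_lt x) le_rfl (pow_pos hpp.pos _)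
      _ = p ^ e := by rw [← pow_add]; congr 1; omega
  have h0 : x.val * p ^ (e - m - 1) = 0 := Nat.eq_zero_of_dvd_of_lt h hlt
  rw [Nat.mul_eq_zero] at h0
  rcases h0 with h0 | h0
  · exact (ZMod.val_eq_zero x).mp h0
  · exact absurd h0 (pow_ne_zero _ hpp.ne_zero)

set_option maxHeartbeats 800000 in
/-- **`∑_v inv_v = 0` on `H²(Γ_K, μ_{p^{m+1}})`, finite places, for classes vanishing at the real places
— any number field `K`, any prime `p`** (Tate VII §10–§11; see the module docstring for the assembly).
The hypothesis `hreal` is automatic for `p` odd and for `K` totally complex; for `p = 2` over a field with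
real places it is achieved by a preliminary correction at the real places.
[cite: CasselsFrohlichANT1967, Ch. VII §10–§11] [cite: MilneADT2006, Ch. I, Thm. 4.10(b)] -/
theorem sum_localInvariantMap_localization_eq_zero_of_forall_isReal (m : ℕ)
    (y : galoisCohomology (mu K (p ^ (m + 1))) 2) (S : Finset (HeightOneSpectrum (𝓞 K)))
    (hS : ∀ v ∉ S, localInvariantMap K (p ^ (m + 1)) v
      (galoisCohomology.localization (mu K (p ^ (m + 1))) (Sum.inr v) 2 y) = 0)
    (hreal : ∀ w : InfinitePlace K, w.IsReal →
      haveI : CompactSpace (absoluteGaloisGroup K) := absoluteGaloisGroup_compactSpace K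
      haveI : CompactSpace (absoluteGaloisGroup w.Completion) := absoluteGaloisGroup_compactSpace _
      galoisCohomology.localization (mu K (p ^ (m + 1))) (Sum.inl w) 2 y = 0) :
    ∑ v ∈ S, localInvariantMap K (p ^ (m + 1)) v
      (galoisCohomology.localization (mu K (p ^ (m + 1))) (Sum.inr v) 2 y) = 0 := by
  classical
  have hpp : p.Prime := hp.out
  haveI : CompactSpace (absoluteGaloisGroup K) := absoluteGaloisGroup_compactSpace K
  obtain ⟨e, hme, y', S', hSS', hyp, hS', hsumT, hrealimp⟩ := exists_correction_trivial_above_p_real K p m y S hS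
  have hreal' := hrealimp hreal
  -- it suffices to treat `y'` over `S'`
  suffices hmain : ∑ v ∈ S', localInvariantMap K (p ^ e) v
      (galoisCohomology.localization (mu K (p ^ e)) (Sum.inr v) 2 y') = 0 by
    have h1 := hsumT S' le_rfl
    rw [hmain] at h1
    have h2 := eq_zero_of_val_mul_pow_eq_zero p hme _ h1.symm
    rw [← h2]
    exact Finset.sum_subset hSS' fun v _ hv => hS v hv
  -- the cyclotomic `ℤ_p`-extension and the killing layer (real-vanishing is used here)
  obtain ⟨κ, hκ⟩ := ZpExtension.exists_isCyclotomic_holds K p (GaloisRep.cyclotomicCharacter_range_infinite K p)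
  have hS'0 : ∀ v ∉ S', galoisCohomology.localization (mu K (p ^ e)) (Sum.inr v) 2 y' = 0 := fun v hv =>
    (localInvariantMap_bijective (K := K) (n := p ^ e) v).1 (by rw [hS' v hv, map_zero])
  obtain ⟨m₀, hm₀⟩ := exists_resH_comap_span_pow_kummer_eq_zero_of_forall_isReal K κ.toContinuousMonoidHom
    (exists_apply_resGal_ne_one_of_isCyclotomic' K p hκ) (dvd_refl (p ^ e)) y' S' hS'0 hreal'
  have hm₀' : resH (κ.layerSubgroup m₀) (units K) 2 ((cohomologyMap (kummerι K (p ^ e)) 2).hom y') = 0 := hm₀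
  -- align the levels: `M ≥ m₀, e`; raise `y'` to level `p^M`
  set M : ℕ := max m₀ e with hMdef
  have heM : p ^ e ∣ p ^ M := pow_dvd_pow p (le_max_right _ _)
  set y'' : galoisCohomology (mu K (p ^ M)) 2 := cohomologyMap (muInclHom K heM) 2 y' with hy''
  -- the Brauer class of `y''` dies on `Gal(K̄/K_M)`
  have hVle : κ.layerSubgroup M ≤ κ.layerSubgroup m₀ := κ.layerSubgroup_antitone (le_max_left _ _)
  have hkill : resH (κ.layerSubgroup M) (units K) 2 ((cohomologyMap (kummerι K (p ^ M)) 2).hom y'') = 0 := by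
    have hK : (cohomologyMap (kummerι K (p ^ M)) 2).hom y'' = (cohomologyMap (kummerι K (p ^ e)) 2).hom y' := by
      rw [hy'']
      exact (map_comp_apply_of (ContinuousMonoidHom.id _) (ContinuousMonoidHom.id _) (ContinuousMonoidHom.id _)
        (fun _ => rfl) (resIdHom (muInclHom K heM)) (resIdHom (kummerι K (p ^ M)))
        (resIdHom (kummerι K (p ^ e))) (fun _ => rfl) 2 y').symm
    rw [hK, resH_eq_resSub_resH (units K) hVle 2]
    change resSub (units K) hVle 2 (resH (κ.layerSubgroup m₀) (units K) 2 _) = 0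
    rw [hm₀', map_zero]
  -- the layer character and the cyclic form of `y''`
  obtain ⟨ψ, hkerV, hkerL, -⟩ := κ.exists_cyclicCharacter_layer M
  haveI : FiniteDimensional K (κ.layer M) := κ.finiteDimensional_layer_holds M
  haveI : IsAbelianGalois K (κ.layer M) := κ.isAbelianGalois_layer M
  haveI : NumberField (κ.layer M) := NumberField.of_module_finite K (κ.layer M)
  have hresψ : resH ψ.ker (units K) 2 ((cohomologyMap (kummerι K (p ^ M)) 2).hom y'') = 0 := by
    rw [hkerV]; exact hkill
  obtain ⟨b, hb⟩ := exists_eq_cupProduct_δ₀_of_resH_eq_zero ψ (κ.layer M) hkerL y'' hresψ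
  -- the class `κ(b) ∪ ψ` vanishes wherever `ψ` is ramified (⊆ the places above `p`)
  have hram : ∀ v : HeightOneSpectrum (𝓞 K),
      (∃ σ ∈ absInertia (v.adicCompletion K), ψ (absGaloisRestrict K (v.adicCompletion K) σ) ≠ 0) →
      galoisCohomology.localization (mu K (p ^ M)) (Sum.inr v) 2 (((mu K (p ^ M)).tateDualPairing (p ^ M)).cupProduct
        ((isSES_kummer K (p ^ M) (NeZero.pos _)).δ₀ (baseUnitsInvariant K (b : K) b.ne_zero))
        (oneCocycleClass _ (scalarCocycle ψ))) = 0 := by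
    rintro v ⟨σ, hσ, hne⟩
    have hpv : (p : 𝓞 K) ∈ v.asIdeal := by
      by_contra hpv
      exact hne (hκ.apply_absGaloisRestrict_eq_zero_of_mem_absInertia hkerV hpv hσ)
    rw [← hb, hy'', localization_muInclHom_eq_zero_iff heM v y']
    exact hyp v hpv
  have hSψ : ∀ v ∉ S', localInvariantMap K (p ^ M) v (galoisCohomology.localization (mu K (p ^ M)) (Sum.inr v) 2
      (((mu K (p ^ M)).tateDualPairing (p ^ M)).cupProduct
        ((isSES_kummer K (p ^ M) (NeZero.pos _)).δ₀ (baseUnitsInvariant K (b : K) b.ne_zero))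
        (oneCocycleClass _ (scalarCocycle ψ)))) = 0 := fun v hv => by
    rw [← hb, hy'', localInvariantMap_localization_muInclHom_eq_zero_iff heM v y']
    exact hS' v hv
  -- the cyclic reciprocity law (the layer `K_M/K` is split at the real places), read back at level `p^e`
  have hsum := sum_localInvariantMap_localization_cupProduct_δ₀_eq_zero (κ.layer M) ψ hkerL b
    (artinIdeleMap_layer_infiniteIdeles_eq_one (κ.layer M) κ M ψ hkerV hkerL _) hram S' hSψ
  rw [← hb, hy'', sum_localInvariantMap_localization_muInclHom_eq_zero_iff heM] at hsum
  exact hsum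

end Literature.NumberTheory.GaloisCohomology

end
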